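import Mathlib
import HarnessLib

/-!
# Venture HSemireg — link-type classes are trace-invisible: every word of length three in
operators of socle type and top type is traceless

HONEST FRAMING. Lean leaf for the computation cell `pub-hsemireg` (theory seat th-3 gen 35; file of
record `run/shared/lean/pub/pub-hsemireg/theory/TH3-LINK-TYPE.md`, 2026-08-25). In the cell's
four-level model of the fibre test for reduced-point complexes (`TH3-SIGMA-ORBIT-PROOF.md` §1) a
configuration is a graded space `M = ⊕ M_p` with three level-raising operators `u_l`; put
`rad M := Σ_l im u_l` and `soc M := ∩_l ker u_l`. A closed class with potentials of *link type*
(`V_j = V_j^s + V_j^t`, `im V_j^s ⊆ soc M`, `V_j^t (rad M) = 0`) has components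
`B_i = V^s_{i+1} u_{i-1} + u_{i-1} V^t_{i+1}`, i.e. `B_i ∈ 𝔰 + 𝔱` with
`𝔰 = {X : im X ⊆ soc, X soc = 0}` and `𝔱 = {Y : im Y ⊆ rad, Y rad = 0}`; one has `𝔰𝔰 = 0 = 𝔱𝔱`, and
every cyclic word of length three in two letters has two cyclically adjacent equal letters. THIS FILE
kernel-checks the resulting statement in two forms: (1) `trace_triple_eq_zero_of_mem_sup` — for any
`k`-algebra `R`, any `k`-linear `τ : R → k` with `τ (a * b) = τ (b * a)`, and any two submodules
`S, T ≤ R` with `S · S = 0` and `T · T = 0`, one has `τ (x * y * z) = 0` for all `x, y, z ∈ S ⊔ T`;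
(2) `trace_triple_eq_zero_of_linkType` — the instance `R = End_k V`, `τ` = the trace, `S`, `T`
consisting of socle-type resp. top-type operators for arbitrary submodules `soc, rad ≤ V`
(`mul_eq_zero_of_range_le_of_le_ker` is the composition-zero step). CONSEQUENCE recorded in the notes
(not formalised here): for three closed classes of link type every level trace of every word
`B_a B'_b B''_c` vanishes, hence the cubic form `T` is level-traceless and `(W³)` holds for such
triples at every amplitude, with no use of (E1)/(E2); the open part of `(W³)₄` is thereby confined to
triples containing a non-link-type («fat») class. No object is constructed; nothing here bears on HC,
HC_CM or HC_AV; `(W³)₄` is not claimed.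
-/

namespace Summit.Ventures.HSemireg

section Abstract

variable {k R : Type*} [CommRing k] [Ring R] [Algebra k R]

/-- Two "square-zero" submodules `S`, `T` of an algebra with a trace-like functional `τ`: every
product of three elements of `S ⊔ T` has `τ = 0`. Proof: expand into the eight pure words; `sss`,
`sst`, `stt`, `tss`, `tts`, `ttt` vanish as elements, and `τ (s t s') = τ (s' s t) = 0`,
`τ (t s t') = τ (t' t s) = 0` by the trace property. [this note, Theorem L, abstract form] -/
theorem trace_triple_eq_zero_of_mem_sup (τ : R →ₗ[k] k)
    (hτ : ∀ a b : R, τ (a * b) = τ (b * a)) (S T : Submodule k R)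
    (hS : ∀ s ∈ S, ∀ s' ∈ S, s * s' = 0) (hT : ∀ t ∈ T, ∀ t' ∈ T, t * t' = 0)
    {x y z : R} (hx : x ∈ S ⊔ T) (hy : y ∈ S ⊔ T) (hz : z ∈ S ⊔ T) :
    τ (x * y * z) = 0 := by
  obtain ⟨xs, hxs, xt, hxt, rfl⟩ := Submodule.mem_sup.mp hx
  obtain ⟨ys, hys, yt, hyt, rfl⟩ := Submodule.mem_sup.mp hy
  obtain ⟨zs, hzs, zt, hzt, rfl⟩ := Submodule.mem_sup.mp hz
  -- the two cyclic identities
  have h_sts : τ (xs * yt * zs) = 0 := by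
    rw [hτ (xs * yt) zs, ← mul_assoc, hS zs hzs xs hxs, zero_mul, map_zero]
  have h_tst : τ (xt * ys * zt) = 0 := by
    rw [hτ (xt * ys) zt, ← mul_assoc, hT zt hzt xt hxt, zero_mul, map_zero]
  -- the six words vanishing as elements
  have e_ss : xs * ys = 0 := hS xs hxs ys hys
  have e_tt : xt * yt = 0 := hT xt hxt yt hyt
  have e_sst : xs * ys * zt = 0 := by rw [e_ss, zero_mul]
  have e_sss : xs * ys * zs = 0 := by rw [e_ss, zero_mul]
  have e_tts : xt * yt * zs = 0 := by rw [e_tt, zero_mul]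
  have e_ttt : xt * yt * zt = 0 := by rw [e_tt, zero_mul]
  have e_stt : xs * yt * zt = 0 := by rw [mul_assoc, hT yt hyt zt hzt, mul_zero]
  have e_tss : xt * ys * zs = 0 := by rw [mul_assoc, hS ys hys zs hzs, mul_zero]
  -- expand
  have hexp : (xs + xt) * (ys + yt) * (zs + zt)
      = xs * ys * zs + xs * ys * zt + xs * yt * zs + xs * yt * zt
        + (xt * ys * zs + xt * ys * zt + xt * yt * zs + xt * yt * zt) := by
    noncomm_ring
  rw [hexp, e_sss, e_sst, e_stt, e_tss, e_tts, e_ttt]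
  simp only [zero_add, add_zero, map_add, h_sts, h_tst]

end Abstract

section Endomorphisms

variable {k V : Type*} [CommRing k] [AddCommGroup V] [Module k V]

/-- Operators of socle type compose to zero: if `soc ≤ ker X` and `im Y ≤ soc` then `X ∘ Y = 0`
(and the same with `rad` in place of `soc` for top type). [this note, §1] -/
theorem mul_eq_zero_of_range_le_of_le_ker (soc : Submodule k V) {X Y : Module.End k V}
    (hX : soc ≤ LinearMap.ker X) (hY : LinearMap.range Y ≤ soc) : X * Y = 0 := by
  ext v
  simp only [Module.End.mul_apply, LinearMap.zero_apply]
  exact LinearMap.mem_ker.mp (hX (hY (LinearMap.mem_range_self Y v)))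

/-- **Theorem L (trace form).** Let `soc, rad ≤ V` be arbitrary submodules and let `S`, `T` be
subspaces of `End V` consisting of socle-type operators (`im X ≤ soc ≤ ker X`) and of top-type
operators (`im Y ≤ rad ≤ ker Y`) respectively. Then every product of three endomorphisms from
`S ⊔ T` has trace zero (Mathlib's trace: the honest one when `V` is finite free). Applied levelwise
to the components `B_i = V^s u + u V^t` of link-type classes this is the vanishing of every level
trace of every word `B_a B'_b B''_c`, hence of `str T`. [this note, Theorem L] -/
theorem trace_triple_eq_zero_of_linkType (soc rad : Submodule k V)
    (S T : Submodule k (Module.End k V))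
    (hS : ∀ X ∈ S, LinearMap.range X ≤ soc ∧ soc ≤ LinearMap.ker X)
    (hT : ∀ Y ∈ T, LinearMap.range Y ≤ rad ∧ rad ≤ LinearMap.ker Y)
    {X Y Z : Module.End k V} (hX : X ∈ S ⊔ T) (hY : Y ∈ S ⊔ T) (hZ : Z ∈ S ⊔ T) :
    LinearMap.trace k V (X * Y * Z) = 0 :=
  trace_triple_eq_zero_of_mem_sup (LinearMap.trace k V) (fun a b => LinearMap.trace_mul_comm k a b)
    S T (fun _ hs _ hs' => mul_eq_zero_of_range_le_of_le_ker soc (hS _ hs).2 (hS _ hs').1)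
    (fun _ ht _ ht' => mul_eq_zero_of_range_le_of_le_ker rad (hT _ ht).2 (hT _ ht').1) hX hY hZ

end Endomorphisms

end Summit.Ventures.HSemireg
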